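import Literature.AnabelianGeometry.EtaleTheta.SettingModelKummerCocycleQ
import Literature.AnabelianGeometry.EtaleTheta.SettingModelCyclotomicCharacterTransport
import HarnessLib

/-!
# The two identifications `Λ(ℚ̄_pˣ) ≃* Ẑ` of the R78 cluster differ by a unit of `Ẑ` commuting with `χ` (proof-only note)

Bookkeeping for the abc-iut cell's R78 cluster (ruling abc-iut-L6-d6 2026-08-26T08:18Z: THE identification of record is
abc-iut-L2-t5's `SettingModel.cycEquiv p` of `SettingModelKummerCocycleQ`; this seat's earlier `SettingModel.cycloZHat p` of
`SettingModelCyclotomicCharacterTransport` stays only as the transport witness).  So that readers see the relation, this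
PROOF-ONLY file (no definition, no instance, no named fact) records: `cycloZHat p = (cycEquiv p).trans v` for the unit
`v := (cycEquiv p)⁻¹ ≫ cycloZHat p ∈ Aut(Ẑ) = Ẑ^×`, and `v` commutes with every `χ(σ)` (`Aut(Ẑ)` is commutative,
`ZHatLevel.mulAut_comm`) — hence every `χ`-equivariance / kernel / open-subgroup statement is insensitive to the choice, and
only Ẑ-VALUED coordinates (Kummer cocycles `κ`) move by `v`.  [RibesZalesskii2010, Thm 2.7.1] (`Aut(Ẑ) ≅ Ẑ^×` abelian)
[cite: RibesZalesskii2010, Thm 2.7.1]; [EtTh] §1 p. 13 [cite: MochizukiEtTh2009, §1 p.13].  No side taken on [IUTchIII] Cor. 3.12.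
-/

noncomputable section

open CategoryTheory ProfiniteGrp ProfiniteGrp.ProfiniteCompletion

namespace Literature.AnabelianGeometry.EtaleTheta.SettingModel

open Literature.AnabelianGeometry.SemiGraphs (GQp)

variable (p : ℕ) [Fact p.Prime]

/-- **`cycloZHat = cycEquiv ≫ v`** with `v := cycEquiv⁻¹ ≫ cycloZHat ∈ Aut(Ẑ)`: the two identifications of the cluster differ
by a unit of `Ẑ`. [cite: RibesZalesskii2010, Thm 2.7.1] -/
theorem cycloZHat_eq_cycEquiv_trans :
    cycloZHat p = (cycEquiv p).trans ((cycEquiv p).symm.trans (cycloZHat p)) := by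
  ext ζ
  simp only [MulEquiv.trans_apply, MulEquiv.symm_apply_apply]

/-- Existential form: `∃ v ∈ Aut(Ẑ), cycloZHat p = (cycEquiv p).trans v`. [cite: RibesZalesskii2010, Thm 2.7.1] -/
theorem exists_cycloZHat_eq_cycEquiv_trans :
    ∃ v : MulAut (completion (GrpCat.of (Multiplicative ℤ))), cycloZHat p = (cycEquiv p).trans v :=
  ⟨_, cycloZHat_eq_cycEquiv_trans p⟩

/-- The comparison unit commutes with `χ(σ)` for every `σ` (`Aut(Ẑ)` is commutative), so `χ`-equivariance statements do
not see the choice of identification. [cite: RibesZalesskii2010, Thm 2.7.1] -/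
theorem cycCompare_comm_chi (σ : GQp p) :
    (cycEquiv p).symm.trans (cycloZHat p) * chi p σ = chi p σ * (cycEquiv p).symm.trans (cycloZHat p) :=
  ZHatLevel.mulAut_comm _ _

/-- Pointwise: `cycloZHat p ζ = v (cycEquiv p ζ)`. [cite: RibesZalesskii2010, Thm 2.7.1] -/
theorem cycloZHat_apply_eq (ζ : cyclotome (PadicAlgCl p)ˣ) :
    cycloZHat p ζ = ((cycEquiv p).symm.trans (cycloZHat p)) (cycEquiv p ζ) := by
  rw [MulEquiv.trans_apply, MulEquiv.symm_apply_apply]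

end Literature.AnabelianGeometry.EtaleTheta.SettingModel

end
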